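import Literature.NumberTheory.EllipticCurves.RealLatticeRealLocusProofs
import Literature.NumberTheory.EllipticCurves.IsogenyComplexUniformizationProofs
import Literature.NumberTheory.EllipticCurves.RealPeriodProofs
import Literature.NumberTheory.EllipticCurves.EichlerShimuraConstructionLatticeProofs
import Mathlib.GroupTheory.Index
import HarnessLib

/-!
# The archimedean local factor of an isogeny (Milne, *ADT*, proof of Thm. I.7.3)

Topic `NumberTheory/EllipticCurves`; a proofs-only file (theorems only: no definitions, no named
facts) on the way to the named fact `WeierstrassCurve.bsdRHS_eq_of_isIsogenous`
(`BSDQuadraticDescent.lean`; Cassels–Tate isogeny invariance of the Birch–Swinnerton-Dyer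
quotient, Milne, *Arithmetic Duality Theorems*, Thm. I.7.3), whose bookkeeping, height,
`Ш`-duality and assembly steps are the sibling files `BSDQuadraticDescentCassels*Proofs.lean`.
In Milne's proof the quotient `L*(A)/L*(B)` of the analytic sides is `∏_{v ∈ S} z(f(K_v))⁻¹`,
`z(f(K_v)) = #ker f(K_v)/#coker f(K_v)`, because the local volumes satisfy
`μ_v(A, f^*ω) = #ker f(K_v) · μ_v(fA(K_v), ω)` and `μ_v(B, ω) = #coker f(K_v) · μ_v(fA(K_v), ω)`
(p. 98).  This file proves the **archimedean case** for elliptic curves: for an isogeny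
`ψ : W → W'` over a subfield `K ⊆ ℝ` with `ψ^*ω' = αω` on the invariant differentials,

  `#ker(ψ_ℂ | W(ℝ)) · Ω(W') = [W'(ℝ) : ψ_ℂ(W(ℝ))] · |α| · Ω(W)`,

`Ω = ∫_{W(ℝ)} |ω|` the real period (`WeierstrassCurve.realPeriod`), i.e.
`z(ψ(ℝ)) = |α| Ω(W)/Ω(W') = μ_∞(W, ψ^*ω')/μ_∞(W', ω')`
(`Isogeny.card_ker_inf_realPoints_mul_realPeriod_eq`, and the hypothesis-free form
`Isogeny.exists_card_ker_inf_realPoints_mul_realPeriod_eq`).  The multiplier `α` is produced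
analytically — `ψ_ℂ(u(z)) = u'(αz)` for the uniformizations `u, u'` of the two models by their
period lattices (Silverman, *AEC*, VI.4.1(b); file `IsogenyComplexUniformizationProofs`) — and
is real.

Proof (Milne's Lemma I.7.2 bookkeeping for `0 → W(ℝ)⁰ → W(ℝ) → π₀(W(ℝ)) → 0`):
`W(ℝ) = u(R)`, `R = {z | conj z − z ∈ Λ} ⊇ ℝ + Λ`, `W(ℝ)⁰ = u(ℝ) ≅ ℝ/ℤΩ₀`; `z ↦ αz` maps `u(ℝ)`
onto `u'(ℝ)` with kernel of order `k₀ = |α|Ω₀/Ω₀'`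
(`PeriodPair.IsReal.relIndex_lattice_mul_minRealPeriod_eq`), the component groups have orders
`[R : ℝ + Λ] = n`, `n' ∈ {1, 2}` (`PeriodPair.IsReal.relIndex_realLine_sup_lattice`) with
`Ω(W) = n Ω₀` (`WeierstrassCurve.exists_periodPair_realPeriod_eq`), and the abstract count
`#ker · n' = k₀ · #coker · n` is `card_ker_inf_mul_relIndex_eq`.

The multiplier is **`K`-rational** (`Isogeny.exists_algebraMap_eq_of_baseChange_apply_eq`:
any `α` with `ψ_ℂ(u(z)) = u'(αz)` is `algebraMap K ℂ k`, by the Galois argument of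
`EichlerShimuraConstructionLatticeProofs` run on the coordinate identity `ψ^*ω' = αω` of
`Isogeny.exists_mul_baseChange_apply_eq_formula`), and the final form
**`Isogeny.exists_algebraMap_card_ker_inf_realPoints_mul_realPeriod_eq`** packages everything:
`∃ k ∈ K, k ≠ 0`, `#ker(ψ_ℂ|W(ℝ)) · Ω(W') = [W'(ℝ) : ψ_ℂ(W(ℝ))] · |k| · Ω(W)`, with `kΛ ⊆ Λ'`,
`ψ_ℂ(u(z)) = u'(kz)` and `ψ^*ω' = kω` in coordinates for every choice of lattices,
uniformizations and rational representations — the *same* `k` whose absolute values at the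
finite places are to give the non-archimedean factors.

What is NOT here: the non-archimedean factors `z(ψ(ℚ_p)) = |k|_p c_p/c'_p` (Tate's algorithm /
formal groups) and the global identity (7.3.1) (Poitou–Tate duality), which remain the open part
of `bsdRHS_eq_of_isIsogenous`.

## References

* J. S. Milne, *Arithmetic Duality Theorems*, 2nd ed. (2006), Ch. I §7: Lemma 7.2, Thm. 7.3
  and its proof, pp. 96–100 (read in the author's PDF, `ADTnot.pdf`, PDF pp. 104–108).
  [MilneADT2006]
* J. H. Silverman, *The Arithmetic of Elliptic Curves*, 2nd ed., GTM 106 (2009), Thm. VI.4.1(b),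
  III.5. [SilvermanAEC2009]
* J. W. S. Cassels, *Arithmetic on curves of genus 1. VIII*, J. reine angew. Math. 217 (1965)
  (the original for elliptic curves).
-/

noncomputable section

open scoped Classical ComplexConjugate

namespace Literature.NumberTheory.EllipticCurves

open AddSubgroup

variable {G G' : Type*} [AddCommGroup G] [AddCommGroup G']

/-- For `H ≤ K`, `[K : H] · #H = #K` (`Nat.card`, junk value `0` when infinite). [folklore] -/
theorem relIndex_mul_natCard_eq {H K : AddSubgroup G} (h : H ≤ K) :
    H.relIndex K * Nat.card H = Nat.card K := by
  have := AddSubgroup.relIndex_mul_relIndex (⊥ : AddSubgroup G) H K bot_le h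
  rw [AddSubgroup.relIndex_bot_left, AddSubgroup.relIndex_bot_left] at this
  rw [mul_comm]
  exact this

/-- **Kernel–cokernel count for a map of filtered groups** (the bookkeeping of Milne, *ADT*,
Lemma I.7.2, for `0 → B → A → A/B → 0`): let `f : G → G'`, `B ≤ A ≤ G`, `B' ≤ A' ≤ G'` with
`f(A) ≤ A'` and `f(B) = B'`. Then
`#(ker f ∩ A) · [A' : B'] = #(ker f ∩ B) · [A' : f(A)] · [A : B]`
(all cardinalities and indices as natural numbers, `0` when infinite).
[cite: MilneADT2006, Ch. I Lemma 7.2, p. 96] -/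
theorem card_ker_inf_mul_relIndex_eq (f : G →+ G') {A B : AddSubgroup G} {A' B' : AddSubgroup G'}
    (hBA : B ≤ A) (hA : A.map f ≤ A') (hB : B.map f = B') :
    Nat.card ↥(f.ker ⊓ A) * B'.relIndex A' =
      Nat.card ↥(f.ker ⊓ B) * (A.map f).relIndex A' * B.relIndex A := by
  set K := f.ker with hK
  -- (4) `[A' : B'] = [f A : B'] · [A' : f A]`
  have hB'fA : B' ≤ A.map f := hB ▸ AddSubgroup.map_mono hBA
  have h4 : B'.relIndex A' = B'.relIndex (A.map f) * (A.map f).relIndex A' :=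
    (AddSubgroup.relIndex_mul_relIndex B' (A.map f) A' hB'fA hA).symm
  -- (3) `[f A : B'] = [A : B + K]`
  have h3 : B'.relIndex (A.map f) = (B ⊔ K).relIndex A := by
    rw [← hB, ← AddSubgroup.relIndex_comap, AddSubgroup.comap_map_eq]
  -- (1) `[A : B] = [(B + K) ∩ A : B] · [A : B + K]`
  have h1 : B.relIndex A = B.relIndex ((B ⊔ K) ⊓ A) * (B ⊔ K).relIndex A := by
    have := AddSubgroup.relIndex_inf_mul_relIndex B (B ⊔ K) A
    rw [inf_of_le_left (le_sup_left : B ≤ B ⊔ K)] at this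
    exact this.symm
  -- (2) `[(B + K) ∩ A : B] = [K ∩ A : K ∩ B]`
  have h2 : B.relIndex ((B ⊔ K) ⊓ A) = (K ⊓ B).relIndex (K ⊓ A) := by
    have hmod : (B ⊔ K) ⊓ A = B ⊔ (K ⊓ A) := by
      apply le_antisymm
      · intro x hx
        rw [AddSubgroup.mem_inf] at hx
        obtain ⟨hx, hxA⟩ := hx
        rw [AddSubgroup.mem_sup] at hx ⊢
        obtain ⟨b, hb, k, hk, rfl⟩ := hx
        refine ⟨b, hb, k, AddSubgroup.mem_inf.mpr ⟨hk, ?_⟩, rfl⟩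
        have : b + k - b ∈ A := A.sub_mem hxA (hBA hb)
        rwa [add_sub_cancel_left] at this
      · exact sup_le (le_inf le_sup_left hBA) (inf_le_inf_right _ le_sup_right)
    rw [hmod, AddSubgroup.relIndex_sup_left, ← AddSubgroup.inf_relIndex_right]
    congr 1
    apply le_antisymm
    · exact le_inf (inf_le_right.trans inf_le_left) inf_le_left
    · exact le_inf inf_le_right (le_inf inf_le_left (inf_le_right.trans hBA))
  have h2' : (K ⊓ B).relIndex (K ⊓ A) * Nat.card ↥(K ⊓ B) = Nat.card ↥(K ⊓ A) :=
    relIndex_mul_natCard_eq (inf_le_inf_left K hBA)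
  rw [h4, h3, h1, h2]
  calc Nat.card ↥(K ⊓ A) * ((B ⊔ K).relIndex A * (A.map f).relIndex A')
      = ((K ⊓ B).relIndex (K ⊓ A) * Nat.card ↥(K ⊓ B)) *
          ((B ⊔ K).relIndex A * (A.map f).relIndex A') := by rw [h2']
    _ = Nat.card ↥(K ⊓ B) * (A.map f).relIndex A' *
          ((K ⊓ B).relIndex (K ⊓ A) * (B ⊔ K).relIndex A) := by ring

end Literature.NumberTheory.EllipticCurves

/-! ## The archimedean local factor of an isogeny -/

namespace PeriodPair

open Complex

/-- If `(α − conj α) w ∈ Λ` for every `w ∈ ℂ` then `α` is real (`Λ ≠ ℂ`: `ω₁/2 ∉ Λ`).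
[folklore] -/
theorem conj_eq_of_forall_mul_mem (L : PeriodPair) {α : ℂ}
    (h : ∀ w, (α - conj α) * w ∈ L.lattice) : conj α = α := by
  by_contra hne
  have hβ : α - conj α ≠ 0 := sub_ne_zero.mpr (Ne.symm hne)
  have := h ((α - conj α)⁻¹ * (L.ω₁ / 2))
  rw [← mul_assoc, mul_inv_cancel₀ hβ, one_mul] at this
  exact L.ω₁_div_two_notMem_lattice this

end PeriodPair

namespace WeierstrassCurve

open PeriodPair Literature.NumberTheory.EllipticCurves

variable {K : Type*} [Field K] [Algebra K ℝ] [Algebra K ℂ] [IsScalarTower K ℝ ℂ]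
  [Algebra (AlgebraicClosure K) ℂ] [IsScalarTower K (AlgebraicClosure K) ℂ]


/-- **Milne, *ADT*, proof of Thm. I.7.3: the archimedean local factor of an isogeny.**
Let `ψ : W → W'` be an isogeny, defined over a subfield `K ⊆ ℝ`, between elliptic curves given by
Weierstrass models `W, W'` over `K`; let `Φ = ψ_ℂ : W(ℂ) → W'(ℂ)` be its base change to complex
points and `W(ℝ) ≤ W(ℂ)`, `W'(ℝ) ≤ W'(ℂ)` the real points.  Let `Λ, Λ'` be the period lattices of
the invariant differentials `ω = dx/(2y + a₁x + a₃)`, `ω'` (`g₂ = c₄/12`, `g₃ = c₆/216`) with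
uniformizations `u, u'`.  Then there is a **real** `α ≠ 0` with `αΛ ⊆ Λ'` and
**`Φ(u(z)) = u'(αz)`** (so `ψ^*ω' = αω`, Silverman *AEC* VI.4.1(b), III.5), and
`#ker(Φ|W(ℝ)) · Ω(W') = [W'(ℝ) : Φ(W(ℝ))] · |α| · Ω(W)`,
where `Ω = ∫_{W(ℝ)} |ω|` is the real period (`WeierstrassCurve.realPeriod` of the model over `ℝ`).
This is `z(f(K_v)) = #ker f(K_v)/#coker f(K_v) = μ_v(A, f^*ω_B)/μ_v(B, ω_B)` at a real place
`v` (Milne, p. 98: "`μ_v(A, ω_A) = [Ker f(K_v)] μ_v(fA(K_v), ω_B)`" and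
"`μ_v(f(A(K_v)), ω_B) = [Coker f(K_v)]⁻¹ μ_v(B(K_v), ω_B)`"), with
`μ_∞(W, αω) = |α| Ω(W)`.  Proof: `W(ℝ) = u(R)`, `R = {conj z ≡ z (Λ)} ⊇ ℝ + Λ` with
`[R : ℝ + Λ] =` number of real components `= Ω(W)/Ω₀` (`Ω₀ = min (Λ ∩ ℝ_{>0})`,
`exists_periodPair_realPeriod_eq`); on `u(ℝ) ≅ ℝ/ℤΩ₀` the map `z ↦ αz` is onto `u'(ℝ)` with
kernel of order `|α|Ω₀/Ω₀'`; the kernel–cokernel count for `0 → u(ℝ) → u(R) → π₀ → 0`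
(`card_ker_inf_mul_relIndex_eq`, Milne's Lemma I.7.2) gives the formula.
[cite: MilneADT2006, Ch. I §7, proof of Thm. 7.3, p. 98; SilvermanAEC2009, Thm. VI.4.1(b)] -/
theorem Isogeny.card_ker_inf_realPoints_mul_realPeriod_eq {W W' : WeierstrassCurve K}
    [W.IsElliptic] [W'.IsElliptic] (ψ : Isogeny W W') {L L' : PeriodPair}
    (h₂ : L.g₂ = (W.baseChange ℂ).c₄ / 12) (h₃ : L.g₃ = (W.baseChange ℂ).c₆ / 216)
    (h₂' : L'.g₂ = (W'.baseChange ℂ).c₄ / 12) (h₃' : L'.g₃ = (W'.baseChange ℂ).c₆ / 216)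
    (u : ℂ →+ (W.baseChange ℂ).toAffine.Point) (hker : (u.ker : Set ℂ) = L.lattice)
    (hu : ∀ z ∉ L.lattice, ∃ hz, u z = .some (℘[L] z - (W.baseChange ℂ).b₂ / 12)
        ((℘'[L] z - (W.baseChange ℂ).a₁ * (℘[L] z - (W.baseChange ℂ).b₂ / 12) -
          (W.baseChange ℂ).a₃) / 2) hz)
    (hsurj : Function.Surjective u)
    (u' : ℂ →+ (W'.baseChange ℂ).toAffine.Point) (hker' : (u'.ker : Set ℂ) = L'.lattice)
    (hu' : ∀ z ∉ L'.lattice, ∃ hz, u' z = .some (℘[L'] z - (W'.baseChange ℂ).b₂ / 12)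
        ((℘'[L'] z - (W'.baseChange ℂ).a₁ * (℘[L'] z - (W'.baseChange ℂ).b₂ / 12) -
          (W'.baseChange ℂ).a₃) / 2) hz)
    (hsurj' : Function.Surjective u') :
    ∃ α : ℝ, α ≠ 0 ∧ (∀ l ∈ L.lattice, (α : ℂ) * l ∈ L'.lattice) ∧
      (∀ z, ψ.baseChange (u z) = u' (α * z)) ∧
      (Nat.card ↥((ψ.baseChange (M := ℂ)).ker ⊓
          (Affine.Point.map (W' := W) (IsScalarTower.toAlgHom K ℝ ℂ)).range) : ℝ) *
          (W'.baseChange ℝ).realPeriod =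
        (((Affine.Point.map (W' := W) (IsScalarTower.toAlgHom K ℝ ℂ)).range.map
            (ψ.baseChange (M := ℂ))).relIndex
            (Affine.Point.map (W' := W') (IsScalarTower.toAlgHom K ℝ ℂ)).range : ℝ) *
          |α| * (W.baseChange ℝ).realPeriod := by
  classical
  haveI hWℝ : (W.baseChange ℝ).IsElliptic := by rw [WeierstrassCurve.baseChange]; infer_instance
  haveI hWℝ' : (W'.baseChange ℝ).IsElliptic := by rw [WeierstrassCurve.baseChange]; infer_instance
  have hreal : L.IsReal := isReal_of_g₂_g₃_eq h₂ h₃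
  have hreal' : L'.IsReal := isReal_of_g₂_g₃_eq h₂' h₃'
  have hkerΛ : u.ker = L.lattice.toAddSubgroup :=
    SetLike.ext' (by rw [hker, Submodule.coe_toAddSubgroup])
  have hkerΛ' : u'.ker = L'.lattice.toAddSubgroup :=
    SetLike.ext' (by rw [hker', Submodule.coe_toAddSubgroup])
  have hmemker' : ∀ w, u' w = 0 ↔ w ∈ L'.lattice := fun w ↦ by
    rw [← SetLike.mem_coe, ← hker']; rfl
  -- the analytic representation (Silverman VI.4.1(b) on all complex points)
  obtain ⟨α, hα0, hαΛ, happ, -⟩ :=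
    ψ.exists_mul_baseChange_apply_eq h₂ h₃ h₂' h₃' u hker hu u' hker' hu'
  -- `α` is real: `Φ`, `u`, `u'` commute with complex conjugation
  obtain ⟨σc, hσc⟩ := exists_algHom_conj (K := K) conj_algebraMap
  have hconj := apply_conj_eq_map_of_uniformization h₂ h₃ u hker hu σc hσc
  have hconj' := apply_conj_eq_map_of_uniformization h₂' h₃' u' hker' hu' σc hσc
  have hαreal : conj α = α := by
    refine L'.conj_eq_of_forall_mul_mem fun w ↦ ?_
    have h1 : u' (α * conj (conj w)) = u' (conj (α * conj w)) := by
      rw [← happ, hconj, ← ψ.map_conj_baseChange σc, happ, hconj']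
    simp only [map_mul, Complex.conj_conj] at h1
    have h3 : u' ((α - conj α) * w) = 0 := by rw [sub_mul, map_sub, h1, sub_self]
    exact (hmemker' _).mp h3
  obtain ⟨a, rfl⟩ : ∃ a : ℝ, (a : ℂ) = α := ⟨α.re, Complex.conj_eq_iff_re.mp hαreal⟩
  have ha0 : a ≠ 0 := fun h ↦ hα0 (by rw [h, Complex.ofReal_zero])
  refine ⟨a, ha0, hαΛ, happ, ?_⟩
  -- the real locus `R`, the real line `B`, and `W(ℝ) = u(R)`
  obtain ⟨R, hR⟩ := L.exists_addSubgroup_realLocus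
  obtain ⟨R', hR'⟩ := L'.exists_addSubgroup_realLocus
  obtain ⟨B, hB⟩ := PeriodPair.exists_addSubgroup_realLine
  rw [range_map_eq_map_realLocus_of_uniformization h₂ h₃ u hker hu hsurj hR,
    range_map_eq_map_realLocus_of_uniformization h₂' h₃' u' hker' hu' hsurj' hR']
  -- the kernel–cokernel count for `0 → u(ℝ) → u(R) → π₀ → 0`
  have hBA : B.map u ≤ R.map u := AddSubgroup.map_mono (realLine_le_realLocus hR hB)
  have hA : (R.map u).map ψ.baseChange ≤ R'.map u' := by
    rintro _ ⟨_, ⟨z, hz, rfl⟩, rfl⟩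
    exact ⟨a * z, mul_mem_realLocus hR hR' hαΛ hz, (happ z).symm⟩
  have hBmap : (B.map u).map ψ.baseChange = B.map u' := by
    apply le_antisymm
    · rintro _ ⟨_, ⟨z, hz, rfl⟩, rfl⟩
      obtain ⟨t, rfl⟩ := exists_eq_ofReal_of_mem_realLine hB hz
      refine ⟨((a * t : ℝ) : ℂ), ofReal_mem_realLine hB _, ?_⟩
      rw [happ]; push_cast; rfl
    · rintro _ ⟨z, hz, rfl⟩
      obtain ⟨t, rfl⟩ := exists_eq_ofReal_of_mem_realLine hB hz
      refine ⟨u ((t / a : ℝ) : ℂ), ⟨_, ofReal_mem_realLine hB _, rfl⟩, ?_⟩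
      rw [happ]
      congr 1
      push_cast
      field_simp
  have hcount := card_ker_inf_mul_relIndex_eq ψ.baseChange hBA hA hBmap
  -- `[u(R) : u(ℝ)] = [R : ℝ + Λ] =` number of real components
  have hc₄ : (((W.baseChange ℝ).c₄ : ℝ) : ℂ) = (W.baseChange ℂ).c₄ := by
    rw [WeierstrassCurve.baseChange, WeierstrassCurve.baseChange, map_c₄, map_c₄,
      ofReal_algebraMap_eq]
  have hc₆ : (((W.baseChange ℝ).c₆ : ℝ) : ℂ) = (W.baseChange ℂ).c₆ := by
    rw [WeierstrassCurve.baseChange, WeierstrassCurve.baseChange, map_c₆, map_c₆,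
      ofReal_algebraMap_eq]
  have hc₄' : (((W'.baseChange ℝ).c₄ : ℝ) : ℂ) = (W'.baseChange ℂ).c₄ := by
    rw [WeierstrassCurve.baseChange, WeierstrassCurve.baseChange, map_c₄, map_c₄,
      ofReal_algebraMap_eq]
  have hc₆' : (((W'.baseChange ℝ).c₆ : ℝ) : ℂ) = (W'.baseChange ℂ).c₆ := by
    rw [WeierstrassCurve.baseChange, WeierstrassCurve.baseChange, map_c₆, map_c₆,
      ofReal_algebraMap_eq]
  have hg₂ : L.g₂ = (((W.baseChange ℝ).c₄ / 12 : ℝ) : ℂ) := by rw [h₂, ← hc₄]; push_cast; ring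
  have hg₃ : L.g₃ = (((W.baseChange ℝ).c₆ / 216 : ℝ) : ℂ) := by rw [h₃, ← hc₆]; push_cast; ring
  have hg₂' : L'.g₂ = (((W'.baseChange ℝ).c₄ / 12 : ℝ) : ℂ) := by
    rw [h₂', ← hc₄']; push_cast; ring
  have hg₃' : L'.g₃ = (((W'.baseChange ℝ).c₆ / 216 : ℝ) : ℂ) := by
    rw [h₃', ← hc₆']; push_cast; ring
  have hdisc : L.g₂.re ^ 3 - 27 * L.g₃.re ^ 2 = (W.baseChange ℝ).Δ := by
    rw [hg₂, hg₃, Complex.ofReal_re, Complex.ofReal_re,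
      show ((W.baseChange ℝ).c₄ / 12) ^ 3 - 27 * ((W.baseChange ℝ).c₆ / 216) ^ 2 =
        ((W.baseChange ℝ).c₄ ^ 3 - (W.baseChange ℝ).c₆ ^ 2) / 1728 by ring,
      ← (W.baseChange ℝ).c_relation]
    ring
  have hdisc' : L'.g₂.re ^ 3 - 27 * L'.g₃.re ^ 2 = (W'.baseChange ℝ).Δ := by
    rw [hg₂', hg₃', Complex.ofReal_re, Complex.ofReal_re,
      show ((W'.baseChange ℝ).c₄ / 12) ^ 3 - 27 * ((W'.baseChange ℝ).c₆ / 216) ^ 2 =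
        ((W'.baseChange ℝ).c₄ ^ 3 - (W'.baseChange ℝ).c₆ ^ 2) / 1728 by ring,
      ← (W'.baseChange ℝ).c_relation]
    ring
  have hΔ : (W.baseChange ℝ).Δ ≠ 0 := (W.baseChange ℝ).isUnit_Δ.ne_zero
  have hΔ' : (W'.baseChange ℝ).Δ ≠ 0 := (W'.baseChange ℝ).isUnit_Δ.ne_zero
  have hn : (B.map u).relIndex (R.map u) = (W.baseChange ℝ).numRealComponents := by
    rw [AddSubgroup.relIndex_map_map, hkerΛ, sup_eq_left.mpr (lattice_le_realLocus hR hreal),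
      hreal.relIndex_realLine_sup_lattice hR hB (by rw [hdisc]; exact hΔ), numRealComponents,
      hdisc]
  have hn' : (B.map u').relIndex (R'.map u') = (W'.baseChange ℝ).numRealComponents := by
    rw [AddSubgroup.relIndex_map_map, hkerΛ', sup_eq_left.mpr (lattice_le_realLocus hR' hreal'),
      hreal'.relIndex_realLine_sup_lattice hR' hB (by rw [hdisc']; exact hΔ'), numRealComponents,
      hdisc']
  -- the kernel on the identity component: `#(ker Φ ∩ u(ℝ)) · Ω₀' = |a| · Ω₀`
  obtain ⟨S, hS⟩ : ∃ S : AddSubgroup ℂ, ∀ z, z ∈ S ↔ (z.re : ℂ) = z ∧ (a : ℂ) * z ∈ L'.lattice :=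
    ⟨B ⊓ L'.lattice.toAddSubgroup.comap (AddMonoidHom.mulLeft (a : ℂ)), fun z ↦ by
      rw [AddSubgroup.mem_inf, hB, AddSubgroup.mem_comap, AddMonoidHom.coe_mulLeft,
        Submodule.mem_toAddSubgroup]⟩
  have hk : ψ.baseChange.ker ⊓ B.map u = S.map u := by
    ext P
    simp only [AddSubgroup.mem_inf, AddMonoidHom.mem_ker, AddSubgroup.mem_map]
    constructor
    · rintro ⟨hP0, z, hz, rfl⟩
      rw [happ, hmemker'] at hP0
      exact ⟨z, (hS z).2 ⟨(hB z).1 hz, hP0⟩, rfl⟩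
    · rintro ⟨z, hz, rfl⟩
      obtain ⟨hzre, haz⟩ := (hS z).1 hz
      refine ⟨?_, z, (hB z).2 hzre, rfl⟩
      rw [happ, hmemker']
      exact haz
  have hk₀ : Nat.card ↥(S.map u) = L.lattice.toAddSubgroup.relIndex S := by
    rw [← AddSubgroup.relIndex_ker, hkerΛ]
  have hk₀Ω := hreal.relIndex_lattice_mul_minRealPeriod_eq hreal' ha0 hαΛ hS
  -- the real periods `Ω = n · Ω₀`
  have hΩ : (W.baseChange ℝ).realPeriod = (W.baseChange ℝ).numRealComponents * L.minRealPeriod := by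
    obtain ⟨L₁, h1₂, h1₃, hΩ₁⟩ := (W.baseChange ℝ).exists_periodPair_realPeriod_eq_holds
    have hlat : L₁.lattice = L.lattice :=
      uniformization_unique_holds L₁ L (by rw [h1₂, hg₂]) (by rw [h1₃, hg₃])
    rw [hΩ₁, minRealPeriod_def, hlat]
  have hΩ' : (W'.baseChange ℝ).realPeriod =
      (W'.baseChange ℝ).numRealComponents * L'.minRealPeriod := by
    obtain ⟨L₁, h1₂, h1₃, hΩ₁⟩ := (W'.baseChange ℝ).exists_periodPair_realPeriod_eq_holds
    have hlat : L₁.lattice = L'.lattice :=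
      uniformization_unique_holds L₁ L' (by rw [h1₂, hg₂']) (by rw [h1₃, hg₃'])
    rw [hΩ₁, minRealPeriod_def, hlat]
  -- assemble
  rw [hk, hk₀, hn, hn'] at hcount
  have hcountℝ : (Nat.card ↥(ψ.baseChange.ker ⊓ R.map u) : ℝ) *
      (W'.baseChange ℝ).numRealComponents =
      (L.lattice.toAddSubgroup.relIndex S : ℝ) * ((R.map u).map ψ.baseChange).relIndex (R'.map u') *
        (W.baseChange ℝ).numRealComponents := by
    exact_mod_cast hcount
  rw [hΩ, hΩ']
  linear_combination L'.minRealPeriod * hcountℝ +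
    (((R.map u).map ψ.baseChange).relIndex (R'.map u') : ℝ) *
      ((W.baseChange ℝ).numRealComponents : ℝ) * hk₀Ω

/-- **The uniformization is determined by the lattice.**  Two uniformizations
`z ↦ (℘(z) − b₂/12, (℘'(z) − a₁x − a₃)/2)` of `V(ℂ)` built from period pairs spanning the same
lattice (and vanishing on it) agree: `℘` depends only on the lattice
(`PeriodPair.weierstrassP_eq_of_lattice_eq`). [folklore] -/
theorem uniformization_eq_of_lattice_eq {V : WeierstrassCurve ℂ} {L₁ L₂ : PeriodPair}
    (hlat : L₁.lattice = L₂.lattice)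
    (u₁ : ℂ →+ V.toAffine.Point) (hker₁ : (u₁.ker : Set ℂ) = L₁.lattice)
    (hu₁ : ∀ z ∉ L₁.lattice, ∃ hz, u₁ z = .some (℘[L₁] z - V.b₂ / 12)
        ((℘'[L₁] z - V.a₁ * (℘[L₁] z - V.b₂ / 12) - V.a₃) / 2) hz)
    (u₂ : ℂ →+ V.toAffine.Point) (hker₂ : (u₂.ker : Set ℂ) = L₂.lattice)
    (hu₂ : ∀ z ∉ L₂.lattice, ∃ hz, u₂ z = .some (℘[L₂] z - V.b₂ / 12)
        ((℘'[L₂] z - V.a₁ * (℘[L₂] z - V.b₂ / 12) - V.a₃) / 2) hz) (z : ℂ) :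
    u₁ z = u₂ z := by
  by_cases hz : z ∈ L₁.lattice
  · have h1 : z ∈ (u₁.ker : Set ℂ) := by rw [hker₁]; exact hz
    have h2 : z ∈ (u₂.ker : Set ℂ) := by rw [hker₂, ← hlat]; exact hz
    exact h1.trans h2.symm
  · have hz₂ : z ∉ L₂.lattice := by rwa [← hlat]
    obtain ⟨h1, e1⟩ := hu₁ z hz
    obtain ⟨h2, e2⟩ := hu₂ z hz₂
    rw [e1, e2, Affine.Point.some.injEq, weierstrassP_eq_of_lattice_eq hlat,
      derivWeierstrassP_eq_of_lattice_eq hlat]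
    exact ⟨rfl, rfl⟩

/-- **The archimedean local factor of an isogeny, hypothesis-free form** (Milne, *ADT*, proof of
Thm. I.7.3 at a real place; see `Isogeny.card_ker_inf_realPoints_mul_realPeriod_eq`).  For an
isogeny `ψ : W → W'` of elliptic curves over `K ⊆ ℝ` there is a real number `α ≠ 0` with
`#ker(ψ_ℂ|W(ℝ)) · Ω(W') = [W'(ℝ) : ψ_ℂ(W(ℝ))] · |α| · Ω(W)`, and `α` is *the* multiplier of
`ψ`: for every choice of period lattices `Λ, Λ'` of the two models (`g₂ = c₄/12`,
`g₃ = c₆/216`) and uniformizations `u, u'`, `αΛ ⊆ Λ'` and `ψ_ℂ(u(z)) = u'(αz)` (so `ψ^*ω' = αω`,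
Silverman, *AEC*, VI.4.1(b)).  The lattices and uniformizations exist
(`WeierstrassCurve.exists_periodPair_realPeriod_eq`, `PeriodPair.exists_addMonoidHom_of_g₂_g₃`)
and are unique (`PeriodPair.uniformization_unique`, `uniformization_eq_of_lattice_eq`).
[cite: MilneADT2006, Ch. I §7, proof of Thm. 7.3, p. 98; SilvermanAEC2009, Thm. VI.4.1(b)] -/
theorem Isogeny.exists_card_ker_inf_realPoints_mul_realPeriod_eq {W W' : WeierstrassCurve K}
    [W.IsElliptic] [W'.IsElliptic] (ψ : Isogeny W W') :
    ∃ α : ℝ, α ≠ 0 ∧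
      (Nat.card ↥((ψ.baseChange (M := ℂ)).ker ⊓
          (Affine.Point.map (W' := W) (IsScalarTower.toAlgHom K ℝ ℂ)).range) : ℝ) *
          (W'.baseChange ℝ).realPeriod =
        (((Affine.Point.map (W' := W) (IsScalarTower.toAlgHom K ℝ ℂ)).range.map
            (ψ.baseChange (M := ℂ))).relIndex
            (Affine.Point.map (W' := W') (IsScalarTower.toAlgHom K ℝ ℂ)).range : ℝ) *
          |α| * (W.baseChange ℝ).realPeriod ∧
      ∀ {L L' : PeriodPair},
        L.g₂ = (W.baseChange ℂ).c₄ / 12 → L.g₃ = (W.baseChange ℂ).c₆ / 216 →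
        L'.g₂ = (W'.baseChange ℂ).c₄ / 12 → L'.g₃ = (W'.baseChange ℂ).c₆ / 216 →
        ∀ (u : ℂ →+ (W.baseChange ℂ).toAffine.Point), (u.ker : Set ℂ) = L.lattice →
        (∀ z ∉ L.lattice, ∃ hz, u z = .some (℘[L] z - (W.baseChange ℂ).b₂ / 12)
          ((℘'[L] z - (W.baseChange ℂ).a₁ * (℘[L] z - (W.baseChange ℂ).b₂ / 12) -
            (W.baseChange ℂ).a₃) / 2) hz) →
        ∀ (u' : ℂ →+ (W'.baseChange ℂ).toAffine.Point), (u'.ker : Set ℂ) = L'.lattice →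
        (∀ z ∉ L'.lattice, ∃ hz, u' z = .some (℘[L'] z - (W'.baseChange ℂ).b₂ / 12)
          ((℘'[L'] z - (W'.baseChange ℂ).a₁ * (℘[L'] z - (W'.baseChange ℂ).b₂ / 12) -
            (W'.baseChange ℂ).a₃) / 2) hz) →
        (∀ l ∈ L.lattice, (α : ℂ) * l ∈ L'.lattice) ∧ ∀ z, ψ.baseChange (u z) = u' (α * z) := by
  haveI hWℝ : (W.baseChange ℝ).IsElliptic := by rw [WeierstrassCurve.baseChange]; infer_instance
  haveI hWℝ' : (W'.baseChange ℝ).IsElliptic := by rw [WeierstrassCurve.baseChange]; infer_instance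
  have hc₄ : (((W.baseChange ℝ).c₄ : ℝ) : ℂ) = (W.baseChange ℂ).c₄ := by
    rw [WeierstrassCurve.baseChange, WeierstrassCurve.baseChange, map_c₄, map_c₄,
      ofReal_algebraMap_eq]
  have hc₆ : (((W.baseChange ℝ).c₆ : ℝ) : ℂ) = (W.baseChange ℂ).c₆ := by
    rw [WeierstrassCurve.baseChange, WeierstrassCurve.baseChange, map_c₆, map_c₆,
      ofReal_algebraMap_eq]
  have hc₄' : (((W'.baseChange ℝ).c₄ : ℝ) : ℂ) = (W'.baseChange ℂ).c₄ := by
    rw [WeierstrassCurve.baseChange, WeierstrassCurve.baseChange, map_c₄, map_c₄,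
      ofReal_algebraMap_eq]
  have hc₆' : (((W'.baseChange ℝ).c₆ : ℝ) : ℂ) = (W'.baseChange ℂ).c₆ := by
    rw [WeierstrassCurve.baseChange, WeierstrassCurve.baseChange, map_c₆, map_c₆,
      ofReal_algebraMap_eq]
  -- the period lattices and uniformizations of the two models
  obtain ⟨L, hL₂, hL₃, -⟩ := (W.baseChange ℝ).exists_periodPair_realPeriod_eq_holds
  obtain ⟨L', hL₂', hL₃', -⟩ := (W'.baseChange ℝ).exists_periodPair_realPeriod_eq_holds
  have h₂ : L.g₂ = (W.baseChange ℂ).c₄ / 12 := by rw [hL₂, ← hc₄]; push_cast; ring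
  have h₃ : L.g₃ = (W.baseChange ℂ).c₆ / 216 := by rw [hL₃, ← hc₆]; push_cast; ring
  have h₂' : L'.g₂ = (W'.baseChange ℂ).c₄ / 12 := by rw [hL₂', ← hc₄']; push_cast; ring
  have h₃' : L'.g₃ = (W'.baseChange ℂ).c₆ / 216 := by rw [hL₃', ← hc₆']; push_cast; ring
  obtain ⟨u, hker, hsurj, hu⟩ := exists_addMonoidHom_of_g₂_g₃ (toPoint_add_holds L) h₂ h₃
  obtain ⟨u', hker', hsurj', hu'⟩ := exists_addMonoidHom_of_g₂_g₃ (toPoint_add_holds L') h₂' h₃'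
  obtain ⟨α, hα0, hαΛ, happ, hperiod⟩ := ψ.card_ker_inf_realPoints_mul_realPeriod_eq
    h₂ h₃ h₂' h₃' u hker hu hsurj u' hker' hu' hsurj'
  refine ⟨α, hα0, hperiod, ?_⟩
  intro L₁ L₁' h1₂ h1₃ h1₂' h1₃' u₁ hker₁ hu₁ u₁' hker₁' hu₁'
  have hlat : L₁.lattice = L.lattice :=
    uniformization_unique_holds L₁ L (by rw [h1₂, h₂]) (by rw [h1₃, h₃])
  have hlat' : L₁'.lattice = L'.lattice :=
    uniformization_unique_holds L₁' L' (by rw [h1₂', h₂']) (by rw [h1₃', h₃'])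
  have hu_eq := uniformization_eq_of_lattice_eq hlat u₁ hker₁ hu₁ u hker hu
  have hu_eq' := uniformization_eq_of_lattice_eq hlat' u₁' hker₁' hu₁' u' hker' hu'
  refine ⟨fun l hl ↦ ?_, fun z ↦ ?_⟩
  · rw [hlat']
    exact hαΛ l (by rwa [← hlat])
  · rw [hu_eq, hu_eq', happ]

end WeierstrassCurve

/-! ## The multiplier is `K`-rational -/

namespace PeriodPair

/-- If `β w ∈ Λ` for every `w ∈ ℂ` then `β = 0` (`Λ ≠ ℂ`: `ω₁/2 ∉ Λ`). [folklore] -/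
theorem eq_zero_of_forall_mul_mem (L : PeriodPair) {β : ℂ} (h : ∀ w, β * w ∈ L.lattice) :
    β = 0 := by
  by_contra hβ
  have := h (β⁻¹ * (L.ω₁ / 2))
  rw [← mul_assoc, mul_inv_cancel₀ hβ, one_mul] at this
  exact L.ω₁_div_two_notMem_lattice this

end PeriodPair

namespace WeierstrassCurve

open PeriodPair Literature.NumberTheory.EllipticCurves

variable {K : Type*} [Field K] [Algebra K ℂ] [Algebra (AlgebraicClosure K) ℂ]
  [IsScalarTower K (AlgebraicClosure K) ℂ]

omit [Algebra K ℂ] [Algebra (AlgebraicClosure K) ℂ] [IsScalarTower K (AlgebraicClosure K) ℂ] in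
/-- An affine point `(x, y)` with `2y + a₁x + a₃ = 0` is a `2`-torsion point: its negative
`(x, −y − a₁x − a₃)` is itself (Silverman, *AEC*, III.2.3). [folklore] -/
theorem two_nsmul_eq_zero_of_two_mul_add_eq_zero {F : Type*} [Field F] {V : WeierstrassCurve F}
    {x y : F} (h : V.toAffine.Nonsingular x y) (hy : 2 * y + V.a₁ * x + V.a₃ = 0) :
    (2 : ℕ) • (Affine.Point.some x y h) = 0 := by
  rw [two_nsmul, add_eq_zero_iff_eq_neg, Affine.Point.neg_some, Affine.Point.some.injEq]
  refine ⟨rfl, ?_⟩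
  simp only [Affine.negY]
  linear_combination hy

/-- **The multiplier of an isogeny is `K`-rational** (`ψ^*ω' = αω` with `α ∈ K` for `ψ, ω, ω'`
defined over `K`; Silverman, *AEC*, III.5 with I.§3).  In the setting of
`Isogeny.exists_mul_baseChange_apply_eq_formula` (`K ⊆ ℂ`, `Λ, Λ'` period lattices of the two
models, `u, u'` their uniformizations), any `α` with `ψ_ℂ(u(z)) = u'(αz)` for all `z` is
`algebraMap K ℂ k` for some `k ∈ K`.  Proof (the Galois argument of
`EichlerShimuraConstructionLatticeProofs`, for arbitrary models): `α` is the analytic multiplier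
(two multipliers differ by a `β` with `βℂ ⊆ Λ'`), hence satisfies the coordinate identity
`α · D(P) = N(P)` at every affine `P ∈ W(K̄)`; at a point off the exceptional set with
`ψ(P) ∉ W'[2]` (`2y' + a₁'x' + a₃' ≠ 0`) one has `D(P) ≠ 0`, so `α = ι(N(P)/D(P)) = ι(α₀)`,
`ι : K̄ → ℂ` the embedding; the conjugate representation at `σP` gives `α = ι(σα₀)` for every
`σ ∈ Γ_K`, so `α₀` is fixed by `Γ_K` and lies in `K`
(`exists_algebraMap_eq_of_forall_absoluteGaloisGroup`).
[cite: SilvermanAEC2009, III.5 (PDF p. 75), I.§3] -/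
theorem Isogeny.exists_algebraMap_eq_of_baseChange_apply_eq {W W' : WeierstrassCurve K}
    [W.IsElliptic] [W'.IsElliptic] (ψ : Isogeny W W') {L L' : PeriodPair}
    (h₂ : L.g₂ = (W.baseChange ℂ).c₄ / 12) (h₃ : L.g₃ = (W.baseChange ℂ).c₆ / 216)
    (h₂' : L'.g₂ = (W'.baseChange ℂ).c₄ / 12) (h₃' : L'.g₃ = (W'.baseChange ℂ).c₆ / 216)
    (u : ℂ →+ (W.baseChange ℂ).toAffine.Point) (hker : (u.ker : Set ℂ) = L.lattice)
    (hu : ∀ z ∉ L.lattice, ∃ hz, u z = .some (℘[L] z - (W.baseChange ℂ).b₂ / 12)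
        ((℘'[L] z - (W.baseChange ℂ).a₁ * (℘[L] z - (W.baseChange ℂ).b₂ / 12) -
          (W.baseChange ℂ).a₃) / 2) hz)
    (u' : ℂ →+ (W'.baseChange ℂ).toAffine.Point) (hker' : (u'.ker : Set ℂ) = L'.lattice)
    (hu' : ∀ z ∉ L'.lattice, ∃ hz, u' z = .some (℘[L'] z - (W'.baseChange ℂ).b₂ / 12)
        ((℘'[L'] z - (W'.baseChange ℂ).a₁ * (℘[L'] z - (W'.baseChange ℂ).b₂ / 12) -
          (W'.baseChange ℂ).a₃) / 2) hz)
    {α : ℂ} (happ : ∀ z, ψ.baseChange (u z) = u' (α * z)) :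
    ∃ k : K, algebraMap K ℂ k = α := by
  classical
  haveI : CharZero K := (algebraMap K ℂ).charZero
  have hmemker' : ∀ w, u' w = 0 ↔ w ∈ L'.lattice := fun w ↦ by
    rw [← SetLike.mem_coe, ← hker']; rfl
  -- `α` is the analytic multiplier, which satisfies the coordinate identity
  obtain ⟨α', -, -, happ', -, hformula⟩ :=
    ψ.exists_mul_baseChange_apply_eq_formula h₂ h₃ h₂' h₃' u hker hu u' hker' hu'
  have hαα' : α = α' := by
    have h0 : α - α' = 0 := by
      refine L'.eq_zero_of_forall_mul_mem fun w ↦ (hmemker' _).1 ?_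
      rw [sub_mul, map_sub, ← happ, ← happ', sub_self]
    exact sub_eq_zero.1 h0
  subst hαα'
  clear happ'
  -- the identity at `K̄`-points: `α · ι(D ρ P) = ι(N ρ P)`
  have hιsome : ∀ {x y : AlgebraicClosure K}
      (h : (W.baseChange (AlgebraicClosure K)).toAffine.Nonsingular x y),
      (W.baseChange ℂ).toAffine.Nonsingular (algebraMap (AlgebraicClosure K) ℂ x)
        (algebraMap (AlgebraicClosure K) ℂ y) := fun h ↦
    ((W.toAffine.baseChange_nonsingular (B := ℂ)
      (IsScalarTower.toAlgHom K (AlgebraicClosure K) ℂ).toRingHom.injective _ _).mpr h)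
  have hkey : ∀ (ρ : RatRep W W' ψ) (x y : AlgebraicClosure K)
      (h : (W.baseChange (AlgebraicClosure K)).toAffine.Nonsingular x y),
      α * (algebraMap (AlgebraicClosure K) ℂ) (MvPolynomial.eval ![x, y]
          (ρ.Q₁ * (MvPolynomial.C 2 * ρ.P₂ * ρ.Q₁ ^ 2 +
            MvPolynomial.C (W'.baseChange (AlgebraicClosure K)).a₁ * ρ.P₁ * ρ.Q₁ * ρ.Q₂ +
            MvPolynomial.C (W'.baseChange (AlgebraicClosure K)).a₃ * ρ.Q₁ ^ 2 * ρ.Q₂))) =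
        (algebraMap (AlgebraicClosure K) ℂ) (MvPolynomial.eval ![x, y]
          (ρ.Q₁ * ρ.Q₂ * ((W.baseChange (AlgebraicClosure K)).invariantDerivation ρ.P₁ * ρ.Q₁ -
            ρ.P₁ * (W.baseChange (AlgebraicClosure K)).invariantDerivation ρ.Q₁))) := by
    intro ρ x y h
    have H := hformula ρ (algebraMap (AlgebraicClosure K) ℂ x) (algebraMap (AlgebraicClosure K) ℂ y)
      (hιsome h)
    rwa [eval_map_algebraMap_vec₂, eval_map_algebraMap_vec₂] at H
  -- a good point `P₀ = (x₀, y₀)`: off the exceptional set of `ρ₀`, with `ψ P₀ ∉ W'[2]`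
  set ρ₀ : RatRep W W' ψ := ψ.ratRep with hρ₀
  have hE2fin : {m : W.geomPoints | (2 : ℕ) • ψ m = 0}.Finite := by
    haveI : (W'.baseChange (AlgebraicClosure K)).IsElliptic := by
      rw [WeierstrassCurve.baseChange]; infer_instance
    have hcard : Nat.card (AddSubgroup.torsionBy W'.geomPoints ((2 : ℕ) : ℤ)) = 2 ^ 2 :=
      WeierstrassCurve.card_torsionBy_eq_sq (E := W'.baseChange (AlgebraicClosure K)) (n := 2)
        (by norm_num)
    have hfin2 :
        (AddSubgroup.torsionBy W'.geomPoints ((2 : ℕ) : ℤ) : Set W'.geomPoints).Finite := by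
      have : Finite (AddSubgroup.torsionBy W'.geomPoints ((2 : ℕ) : ℤ)) :=
        Nat.finite_of_card_ne_zero (by rw [hcard]; norm_num)
      exact Set.toFinite _
    have hpre := PeriodPair.finite_preimage_of_finite_ker ψ.toAddMonoidHom ψ.finite_ker hfin2
    refine hpre.subset fun m hm ↦ ?_
    simp only [Set.mem_setOf_eq] at hm
    simp only [Set.mem_preimage, SetLike.mem_coe, AddSubgroup.torsionBy.nsmul_iff,
      Isogeny.coe_toAddMonoidHom]
    exact hm
  obtain ⟨P₀, hP₀⟩ :=
    Infinite.exists_notMem_finset ((ρ₀.exc : Finset W.geomPoints) ∪ hE2fin.toFinset)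
  rw [Finset.mem_union, not_or] at hP₀
  obtain ⟨hP₀exc, hP₀2⟩ := hP₀
  have hP₀2' : ¬ (2 : ℕ) • ψ P₀ = 0 := fun h ↦ hP₀2 (hE2fin.mem_toFinset.2 h)
  obtain ⟨x₀, y₀, h₀, rfl⟩ : ∃ x₀ y₀ h₀, P₀ = .some x₀ y₀ h₀ := by
    change (W.baseChange (AlgebraicClosure K)).toAffine.Point at P₀
    rcases P₀ with _ | ⟨x₀, y₀, h₀⟩
    · exact (hP₀exc ρ₀.zero_mem_exc).elim
    · exact ⟨x₀, y₀, h₀, rfl⟩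
  obtain ⟨hQ₁0, hQ₂0, h₀', hψP₀⟩ := ρ₀.apply_eq_of_not_mem_exc h₀ hP₀exc
  -- `D₀ = Q₁³Q₂ · (2y' + a₁'x' + a₃') ≠ 0`
  have hg0 : 2 * (MvPolynomial.eval ![x₀, y₀] ρ₀.P₂ / MvPolynomial.eval ![x₀, y₀] ρ₀.Q₂) +
      (W'.baseChange (AlgebraicClosure K)).a₁ *
        (MvPolynomial.eval ![x₀, y₀] ρ₀.P₁ / MvPolynomial.eval ![x₀, y₀] ρ₀.Q₁) +
      (W'.baseChange (AlgebraicClosure K)).a₃ ≠ 0 := by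
    intro hz
    apply hP₀2'
    rw [hψP₀]
    exact two_nsmul_eq_zero_of_two_mul_add_eq_zero h₀' hz
  set D₀ : AlgebraicClosure K := MvPolynomial.eval ![x₀, y₀]
      (ρ₀.Q₁ * (MvPolynomial.C 2 * ρ₀.P₂ * ρ₀.Q₁ ^ 2 +
        MvPolynomial.C (W'.baseChange (AlgebraicClosure K)).a₁ * ρ₀.P₁ * ρ₀.Q₁ * ρ₀.Q₂ +
        MvPolynomial.C (W'.baseChange (AlgebraicClosure K)).a₃ * ρ₀.Q₁ ^ 2 * ρ₀.Q₂)) with hD₀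
  set N₀ : AlgebraicClosure K := MvPolynomial.eval ![x₀, y₀]
      (ρ₀.Q₁ * ρ₀.Q₂ * ((W.baseChange (AlgebraicClosure K)).invariantDerivation ρ₀.P₁ * ρ₀.Q₁ -
        ρ₀.P₁ * (W.baseChange (AlgebraicClosure K)).invariantDerivation ρ₀.Q₁)) with hN₀
  have hD₀ne : D₀ ≠ 0 := by
    have hexp : D₀ = MvPolynomial.eval ![x₀, y₀] ρ₀.Q₁ ^ 3 * MvPolynomial.eval ![x₀, y₀] ρ₀.Q₂ *
        (2 * (MvPolynomial.eval ![x₀, y₀] ρ₀.P₂ / MvPolynomial.eval ![x₀, y₀] ρ₀.Q₂) +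
          (W'.baseChange (AlgebraicClosure K)).a₁ *
            (MvPolynomial.eval ![x₀, y₀] ρ₀.P₁ / MvPolynomial.eval ![x₀, y₀] ρ₀.Q₁) +
          (W'.baseChange (AlgebraicClosure K)).a₃) := by
      simp only [hD₀, map_mul, map_add, map_pow, MvPolynomial.eval_C]
      field_simp
    rw [hexp]
    exact mul_ne_zero (mul_ne_zero (pow_ne_zero 3 hQ₁0) hQ₂0) hg0
  -- `α = (algebraMap (AlgebraicClosure K) ℂ) α₀`, `α₀ = N₀ / D₀ ∈ K̄`
  set α₀ : AlgebraicClosure K := N₀ / D₀ with hα₀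
  have hαι : α = (algebraMap (AlgebraicClosure K) ℂ) α₀ := by
    have H := hkey ρ₀ x₀ y₀ h₀
    rw [hα₀, map_div₀, eq_div_iff ((map_ne_zero (algebraMap (AlgebraicClosure K) ℂ)).2 hD₀ne)]
    exact H
  -- `α₀` is fixed by `Γ_K`
  have hfix : ∀ σ : Field.absoluteGaloisGroup K,
      Field.absoluteGaloisGroup.toAlgEquiv K σ α₀ = α₀ := by
    intro σ
    set τ : AlgebraicClosure K ≃ₐ[K] AlgebraicClosure K :=
      Field.absoluteGaloisGroup.toAlgEquiv K σ with hτ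
    set ρσ : RatRep W W' ψ := ρ₀.conj σ (fun P ↦ ψ.map_smul σ P) with hρσ
    obtain ⟨hσns, eσ⟩ := geomPoints.smul_some (W := W) σ h₀
    have H := hkey ρσ _ _ hσns
    have hEQσ : (W.baseChange (AlgebraicClosure K)).map (RatRep.galHom σ) =
        W.baseChange (AlgebraicClosure K) := by
      simp only [WeierstrassCurve.baseChange, WeierstrassCurve.map_map]
      congr 1
      ext a
      simp
    have hEQσ' : (W'.baseChange (AlgebraicClosure K)).map (RatRep.galHom σ) =
        W'.baseChange (AlgebraicClosure K) := by
      simp only [WeierstrassCurve.baseChange, WeierstrassCurve.map_map]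
      congr 1
      ext a
      simp
    have hσa₁ : RatRep.galHom σ (W'.baseChange (AlgebraicClosure K)).a₁ =
        (W'.baseChange (AlgebraicClosure K)).a₁ := by
      conv_rhs => rw [← hEQσ']
      rfl
    have hσa₃ : RatRep.galHom σ (W'.baseChange (AlgebraicClosure K)).a₃ =
        (W'.baseChange (AlgebraicClosure K)).a₃ := by
      conv_rhs => rw [← hEQσ']
      rfl
    have e1 : ρσ.Q₁ * (MvPolynomial.C 2 * ρσ.P₂ * ρσ.Q₁ ^ 2 +
          MvPolynomial.C (W'.baseChange (AlgebraicClosure K)).a₁ * ρσ.P₁ * ρσ.Q₁ * ρσ.Q₂ +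
          MvPolynomial.C (W'.baseChange (AlgebraicClosure K)).a₃ * ρσ.Q₁ ^ 2 * ρσ.Q₂) =
        MvPolynomial.map (RatRep.galHom σ)
          (ρ₀.Q₁ * (MvPolynomial.C 2 * ρ₀.P₂ * ρ₀.Q₁ ^ 2 +
            MvPolynomial.C (W'.baseChange (AlgebraicClosure K)).a₁ * ρ₀.P₁ * ρ₀.Q₁ * ρ₀.Q₂ +
            MvPolynomial.C (W'.baseChange (AlgebraicClosure K)).a₃ * ρ₀.Q₁ ^ 2 * ρ₀.Q₂)) := by
      simp only [hρσ, RatRep.conj_P₁, RatRep.conj_P₂, RatRep.conj_Q₁, RatRep.conj_Q₂, map_mul,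
        map_add, map_pow, MvPolynomial.map_C, map_ofNat, hσa₁, hσa₃]
    have e2 : ρσ.Q₁ * ρσ.Q₂ * ((W.baseChange (AlgebraicClosure K)).invariantDerivation ρσ.P₁ *
          ρσ.Q₁ - ρσ.P₁ * (W.baseChange (AlgebraicClosure K)).invariantDerivation ρσ.Q₁) =
        MvPolynomial.map (RatRep.galHom σ)
          (ρ₀.Q₁ * ρ₀.Q₂ * ((W.baseChange (AlgebraicClosure K)).invariantDerivation ρ₀.P₁ *
            ρ₀.Q₁ - ρ₀.P₁ * (W.baseChange (AlgebraicClosure K)).invariantDerivation ρ₀.Q₁)) := by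
      simp only [hρσ, RatRep.conj_P₁, RatRep.conj_Q₁, RatRep.conj_Q₂]
      conv_lhs => rw [← hEQσ]
      rw [WeierstrassCurve.invariantDerivation_map, WeierstrassCurve.invariantDerivation_map]
      simp only [map_mul, map_sub]
    rw [e1, e2, ← RatRep.galois_eval_vec₂, ← RatRep.galois_eval_vec₂] at H
    have hτD : τ D₀ ≠ 0 := (map_ne_zero τ).2 hD₀ne
    have hα' : α = (algebraMap (AlgebraicClosure K) ℂ) (τ α₀) := by
      rw [hα₀, map_div₀, map_div₀,
        eq_div_iff ((map_ne_zero (algebraMap (AlgebraicClosure K) ℂ)).2 hτD)]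
      exact H
    have : algebraMap (AlgebraicClosure K) ℂ (τ α₀) = algebraMap (AlgebraicClosure K) ℂ α₀ :=
      hα'.symm.trans hαι
    exact (algebraMap (AlgebraicClosure K) ℂ).injective this
  -- Galois descent
  obtain ⟨k, hk⟩ := exists_algebraMap_eq_of_forall_absoluteGaloisGroup hfix
  refine ⟨k, ?_⟩
  rw [hαι, ← hk]
  exact IsScalarTower.algebraMap_apply K (AlgebraicClosure K) ℂ k

end WeierstrassCurve

/-! ## The archimedean local factor with the `K`-rational multiplier -/

namespace WeierstrassCurve

open PeriodPair Literature.NumberTheory.EllipticCurves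

variable {K : Type*} [Field K] [Algebra K ℝ] [Algebra K ℂ] [IsScalarTower K ℝ ℂ]
  [Algebra (AlgebraicClosure K) ℂ] [IsScalarTower K (AlgebraicClosure K) ℂ]

/-- **Milne, *ADT*, proof of Thm. I.7.3 — the archimedean local factor of an isogeny, with its
`K`-rational multiplier.**  For an isogeny `ψ : W → W'` of elliptic curves over `K ⊆ ℝ` there is
`k ∈ K`, `k ≠ 0`, such that

  `#ker(ψ_ℂ | W(ℝ)) · Ω(W') = [W'(ℝ) : ψ_ℂ(W(ℝ))] · |k| · Ω(W)`

(`Ω` the real period `∫_{W(ℝ)}|ω|` of the model over `ℝ`), and `k` is the pull-back multiplier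
`ψ^*ω' = kω` of the invariant differentials: for all period lattices `Λ, Λ'` and uniformizations
`u, u'` of the two models, `kΛ ⊆ Λ'`, `ψ_ℂ(u(z)) = u'(kz)`, and for every rational
representation `(P₁/Q₁, P₂/Q₂)` of `ψ` and every affine `(x, y) ∈ W(ℂ)`,
`k · (Q₁(2P₂Q₁² + a₁'P₁Q₁Q₂ + a₃'Q₁²Q₂))(x, y) = (Q₁Q₂(δP₁·Q₁ − P₁·δQ₁))(x, y)`.  So
`z(ψ(ℝ)) = #ker/#coker = |k| Ω(W)/Ω(W') = μ_∞(W, ψ^*ω')/μ_∞(W', ω')` with the *same* `k ∈ K`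
whose absolute values at the finite places give the non-archimedean factors (Milne, p. 98;
for `K = ℚ`, `∏_v |k|_v = 1`).  Assembled from
`Isogeny.exists_card_ker_inf_realPoints_mul_realPeriod_eq`,
`Isogeny.exists_algebraMap_eq_of_baseChange_apply_eq` and
`Isogeny.exists_mul_baseChange_apply_eq_formula`.
[cite: MilneADT2006, Ch. I §7, proof of Thm. 7.3, p. 98; SilvermanAEC2009, Thm. VI.4.1(b), III.5] -/
theorem Isogeny.exists_algebraMap_card_ker_inf_realPoints_mul_realPeriod_eq
    {W W' : WeierstrassCurve K} [W.IsElliptic] [W'.IsElliptic] (ψ : Isogeny W W') :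
    ∃ k : K, k ≠ 0 ∧
      (Nat.card ↥((ψ.baseChange (M := ℂ)).ker ⊓
          (Affine.Point.map (W' := W) (IsScalarTower.toAlgHom K ℝ ℂ)).range) : ℝ) *
          (W'.baseChange ℝ).realPeriod =
        (((Affine.Point.map (W' := W) (IsScalarTower.toAlgHom K ℝ ℂ)).range.map
            (ψ.baseChange (M := ℂ))).relIndex
            (Affine.Point.map (W' := W') (IsScalarTower.toAlgHom K ℝ ℂ)).range : ℝ) *
          |algebraMap K ℝ k| * (W.baseChange ℝ).realPeriod ∧
      ∀ {L L' : PeriodPair},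
        L.g₂ = (W.baseChange ℂ).c₄ / 12 → L.g₃ = (W.baseChange ℂ).c₆ / 216 →
        L'.g₂ = (W'.baseChange ℂ).c₄ / 12 → L'.g₃ = (W'.baseChange ℂ).c₆ / 216 →
        ∀ (u : ℂ →+ (W.baseChange ℂ).toAffine.Point), (u.ker : Set ℂ) = L.lattice →
        (∀ z ∉ L.lattice, ∃ hz, u z = .some (℘[L] z - (W.baseChange ℂ).b₂ / 12)
          ((℘'[L] z - (W.baseChange ℂ).a₁ * (℘[L] z - (W.baseChange ℂ).b₂ / 12) -
            (W.baseChange ℂ).a₃) / 2) hz) →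
        ∀ (u' : ℂ →+ (W'.baseChange ℂ).toAffine.Point), (u'.ker : Set ℂ) = L'.lattice →
        (∀ z ∉ L'.lattice, ∃ hz, u' z = .some (℘[L'] z - (W'.baseChange ℂ).b₂ / 12)
          ((℘'[L'] z - (W'.baseChange ℂ).a₁ * (℘[L'] z - (W'.baseChange ℂ).b₂ / 12) -
            (W'.baseChange ℂ).a₃) / 2) hz) →
        (∀ l ∈ L.lattice, algebraMap K ℂ k * l ∈ L'.lattice) ∧
        (∀ z, ψ.baseChange (u z) = u' (algebraMap K ℂ k * z)) ∧
        ∀ (ρ : RatRep W W' ψ) (x y : ℂ), (W.baseChange ℂ).toAffine.Nonsingular x y →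
          algebraMap K ℂ k * MvPolynomial.eval ![x, y]
              (MvPolynomial.map (algebraMap (AlgebraicClosure K) ℂ)
                (ρ.Q₁ * (MvPolynomial.C 2 * ρ.P₂ * ρ.Q₁ ^ 2 +
                  MvPolynomial.C (W'.baseChange (AlgebraicClosure K)).a₁ * ρ.P₁ * ρ.Q₁ * ρ.Q₂ +
                  MvPolynomial.C (W'.baseChange (AlgebraicClosure K)).a₃ * ρ.Q₁ ^ 2 * ρ.Q₂))) =
            MvPolynomial.eval ![x, y] (MvPolynomial.map (algebraMap (AlgebraicClosure K) ℂ)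
              (ρ.Q₁ * ρ.Q₂ *
                ((W.baseChange (AlgebraicClosure K)).invariantDerivation ρ.P₁ * ρ.Q₁ -
                  ρ.P₁ * (W.baseChange (AlgebraicClosure K)).invariantDerivation ρ.Q₁))) := by
  haveI hWℝ : (W.baseChange ℝ).IsElliptic := by rw [WeierstrassCurve.baseChange]; infer_instance
  haveI hWℝ' : (W'.baseChange ℝ).IsElliptic := by rw [WeierstrassCurve.baseChange]; infer_instance
  obtain ⟨α, hα0, hperiod, hall⟩ := ψ.exists_card_ker_inf_realPoints_mul_realPeriod_eq
  -- a choice of period lattices and uniformizations, to identify `α` as a `K`-rational number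
  have hc₄ : (((W.baseChange ℝ).c₄ : ℝ) : ℂ) = (W.baseChange ℂ).c₄ := by
    rw [WeierstrassCurve.baseChange, WeierstrassCurve.baseChange, map_c₄, map_c₄,
      ofReal_algebraMap_eq]
  have hc₆ : (((W.baseChange ℝ).c₆ : ℝ) : ℂ) = (W.baseChange ℂ).c₆ := by
    rw [WeierstrassCurve.baseChange, WeierstrassCurve.baseChange, map_c₆, map_c₆,
      ofReal_algebraMap_eq]
  have hc₄' : (((W'.baseChange ℝ).c₄ : ℝ) : ℂ) = (W'.baseChange ℂ).c₄ := by
    rw [WeierstrassCurve.baseChange, WeierstrassCurve.baseChange, map_c₄, map_c₄,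
      ofReal_algebraMap_eq]
  have hc₆' : (((W'.baseChange ℝ).c₆ : ℝ) : ℂ) = (W'.baseChange ℂ).c₆ := by
    rw [WeierstrassCurve.baseChange, WeierstrassCurve.baseChange, map_c₆, map_c₆,
      ofReal_algebraMap_eq]
  obtain ⟨L, hL₂, hL₃, -⟩ := (W.baseChange ℝ).exists_periodPair_realPeriod_eq_holds
  obtain ⟨L', hL₂', hL₃', -⟩ := (W'.baseChange ℝ).exists_periodPair_realPeriod_eq_holds
  have h₂ : L.g₂ = (W.baseChange ℂ).c₄ / 12 := by rw [hL₂, ← hc₄]; push_cast; ring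
  have h₃ : L.g₃ = (W.baseChange ℂ).c₆ / 216 := by rw [hL₃, ← hc₆]; push_cast; ring
  have h₂' : L'.g₂ = (W'.baseChange ℂ).c₄ / 12 := by rw [hL₂', ← hc₄']; push_cast; ring
  have h₃' : L'.g₃ = (W'.baseChange ℂ).c₆ / 216 := by rw [hL₃', ← hc₆']; push_cast; ring
  obtain ⟨u, hker, -, hu⟩ := exists_addMonoidHom_of_g₂_g₃ (toPoint_add_holds L) h₂ h₃
  obtain ⟨u', hker', -, hu'⟩ := exists_addMonoidHom_of_g₂_g₃ (toPoint_add_holds L') h₂' h₃'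
  obtain ⟨-, happ⟩ := hall h₂ h₃ h₂' h₃' u hker hu u' hker' hu'
  obtain ⟨k, hk⟩ := ψ.exists_algebraMap_eq_of_baseChange_apply_eq h₂ h₃ h₂' h₃' u hker hu
    u' hker' hu' happ
  have hkℝ : algebraMap K ℝ k = α :=
    Complex.ofReal_injective (by rw [ofReal_algebraMap_eq, hk])
  refine ⟨k, ?_, ?_, ?_⟩
  · rintro rfl
    rw [map_zero] at hkℝ
    exact hα0 hkℝ.symm
  · rw [hkℝ]
    exact hperiod
  · intro L₁ L₁' h1₂ h1₃ h1₂' h1₃' u₁ hker₁ hu₁ u₁' hker₁' hu₁'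
    obtain ⟨hαΛ₁, happ₁⟩ := hall h1₂ h1₃ h1₂' h1₃' u₁ hker₁ hu₁ u₁' hker₁' hu₁'
    rw [hk]
    refine ⟨hαΛ₁, happ₁, fun ρ x y hxy ↦ ?_⟩
    -- the analytic multiplier at `(Λ₁, u₁; Λ₁', u₁')` is again `α`
    obtain ⟨α₃, -, -, happ₃, -, hformula₃⟩ :=
      ψ.exists_mul_baseChange_apply_eq_formula h1₂ h1₃ h1₂' h1₃' u₁ hker₁ hu₁ u₁' hker₁' hu₁'
    have hmemker₁' : ∀ w, u₁' w = 0 ↔ w ∈ L₁'.lattice := fun w ↦ by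
      rw [← SetLike.mem_coe, ← hker₁']; rfl
    have hα₃ : α₃ = (α : ℂ) := by
      have h0 : α₃ - α = 0 := by
        refine L₁'.eq_zero_of_forall_mul_mem fun w ↦ (hmemker₁' _).1 ?_
        rw [sub_mul, map_sub, ← happ₃, ← happ₁, sub_self]
      exact sub_eq_zero.1 h0
    rw [← hα₃]
    exact hformula₃ ρ x y hxy

end WeierstrassCurve
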